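import Summits.QuantumFields.BalabanUV.T4Continuum.Support.ShellMeasureRootCompositionSeam

/-!
# `T4Continuum.ShellMeasureSeamDominated` — SM-L6 (MR)_j WIRED INTO THE SEAM: END-I's per-slot wall binder `hac` for a
# slot measure DOMINATED by one that satisfies (M1) (END-II's output ∕ the level-0 faces), with the MASS RATIO by level
# DISPLAYED — kernel bookkeeping, no estimate
(cell `pub-balaban`, sub-cell `t4`, spine estimate NE7c (node U5b); NE7c ROUND-2 crew `t4-ne7c-formalise-*`, seat
`b2b-balaban-t4-ne7c-formalise-leaf-01`, OFFERED row «SM-L6 LIVE WIRING» of the claim table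
`t4/b2b-balaban-t4-ne7c-p1/LEAVES-NE7c-P1.md` (the owner books ∕ renames ∕ refuses); ADDITIVE — imports the seam
`ShellMeasureRootCompositionSeam` (row S13, p208381) only; 0 `def`, 0 sorry, 0 citations)

HONEST FRAMING.  Finite four-torus programme, rung (B)+1 only — NOT infinite volume, NOT a mass gap, NOT the Clay
problem, NOT summit progress.  NE7c = `T4IndicatorShell.ShellWeightBound` is NOT PRINTED in [Balaban 1983–89] and NOT
PROVED; «NE7c ⇐ the named binders» (trigger c3).  The skeleton's leaf SM-L6 — «(MR) dropped straddling co-tests: mass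
ratio `M` between the slot-summed-out measure and the one with the straddling neighbour indicators summed over
candidates; `T4ShellMeasureFibre.slotAntiConcentration_of_dominated` (constant `D·M`); BINDER (small-field dominance,
B15 p. 193 ∕ B16 p. 383 TYPE); located, NOT PRINTED as an instance» — was made kernel AT LEVEL 0 by row S2
(`ShellMeasureWilsonStraddle`, p208215: the mass ratio displayed as `hmass`).  AT A LIVE LEVEL the seam
(`ShellMeasureRootCompositionSeam.shellWeightBound_of_levelDataSU2`, p208381) asks END-I's wall per slot for the run's
ACTUAL realized slot measure `(fieldMeasure P (lvl K s) SU2).withDensity (FX K t s)` (reading (R): the integrand with the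
slot's OWN indicator removed — exterior straddling co-tests still inside), while END-II delivers (M1) for a density of
its admissible shape (kept co-tests inside a centre-monotone `Jco`; the others must be DROPPED).  THIS FILE is the
one-line wiring between the two: if the actual density is DOMINATED by an END-II-amenable one (`FX ≤ F′X` — dropping
an indicator factor `≤ 1`), (M1) holds for `F′X` with slot constant `Dslot`, and the MASS RATIO `μ_{F′}(univ) ≤
M_{lvl}·μ_{F}(univ)` is DISPLAYED (SM-L6 at level `lvl K s` — an ESTIMATE, small-field dominance, NOT PRINTED as an
instance, asserted by nobody), then END-I's `hac` holds for `FX` with slot constant `Dslot·M_{lvl}` — by the Literature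
lemma `T4ShellMeasureFibre.slotAntiConcentration_of_dominated`, per slot.  Conclusions are LITERALLY the seam END's
`hacX` binder type (slot-constant form) resp. END-I's (level-constant form, via the seam's `hac_of_slotConst`).  No
`def … : Prop` (c2); nothing discharged; no rate (c4).  HONEST DEPENDENCY (cell): continuum YM on T⁴ ⇐ BetaPertH ∧ nine
spine estimates (0/9 proved); BetaPertH ⇐ (D1) ∧ (D4) ∧ CAP+tail; G-an2-4 gates asym, D1 and NE2/3/4.

## What is proved ([folklore] bookkeeping)
* §1 any slot family: `hac_dominated_slot` (per slot: shell domination `μ shell ≤ μ′ shell` + (M1) for `μ′` with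
  `Dslot` + mass ratio `M (lvl K s)` ⇒ (M1) for `μ` with `Dslot K t s * M (lvl K s)`), `hac_dominated_level` (+ a level
  majorant `Dslot·M ≤ D ∘ lvl` ⇒ END-I's `hac` verbatim, via `hac_of_slotConst`).
* §2 the realized `SU(2)` family: `withDensity_apply_le_of_le` (density domination ⇒ set-wise domination),
  **`hac_dominatedLevelData`** (densities `FX ≤ F′X`, (M1) for `F′X` — END-II's output shape —, mass ratio by level ⇒
  the seam END's `hacX` for `FX` with slot constants `Dslot·M_{lvl}`), `hac_dominatedLevelData_level` (level form).

WHAT THIS DOES NOT DO.  It does not bound any mass ratio (SM-L6 at `j ≥ 1` stays THE located estimate); (M1), NE7c NOT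
proved; 0/9 spine.
-/

noncomputable section

open MeasureTheory
open scoped ENNReal

namespace Summit.QuantumFields.BalabanUV.T4Continuum.ShellMeasureSeamDominated

open Literature.MathematicalPhysics.QuantumFieldTheory.Balaban1983to89
open T4ShellMeasure (SlotAntiConcentration)
open T4ShellMeasureFibre (slotAntiConcentration_of_dominated)
open T4CubeChartGnomonic (SU2)
open ShellMeasureRootCompositionSeam (hac_of_slotConst)

/-! ## §1 Any slot family -/

section AnyFamily

variable {σ : Type*} {Ω : ℕ → σ → Type*} [∀ K s, MeasurableSpace (Ω K s)] {l₀ : ℝ} {S : ℕ → Finset σ}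
  {lvl : ℕ → σ → ℕ} {μ μ' : ∀ K : ℕ, ℝ → ∀ s : σ, Measure (Ω K s)} {u : ∀ K : ℕ, ℝ → ∀ s : σ, Ω K s → ℝ}
  {θ D ρ M : ℕ → ℝ} {Dslot : ℕ → ℝ → σ → ℝ}

/-- **SM-L6 PER SLOT (slot-constant form).**  Per slot `s ∈ S K` at source `|t| ≤ l₀`: the slot's realized measure
`μ K t s` is dominated ON THE SHELL EVENT by a measure `μ′ K t s` which satisfies (M1) with slot constant
`Dslot K t s ≥ 0`, and the MASS RATIO `μ′(univ) ≤ M_{lvl K s}·μ(univ)` is displayed ⟹ (M1) for `μ K t s` with slot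
constant `Dslot K t s · M (lvl K s)` (`T4ShellMeasureFibre.slotAntiConcentration_of_dominated`).  CONDITIONAL on the
displayed mass ratio; nothing PRINTED is asserted. [folklore] -/
theorem hac_dominated_slot (hρ : ∀ j, 0 ≤ ρ j) (hDslot0 : ∀ K t, |t| ≤ l₀ → ∀ s ∈ S K, 0 ≤ Dslot K t s)
    (hS : ∀ K t, |t| ≤ l₀ → ∀ s ∈ S K,
      μ K t s {x | θ (lvl K s) * (1 - ρ (lvl K s)) ≤ u K t s x ∧ u K t s x < θ (lvl K s)} ≤
        μ' K t s {x | θ (lvl K s) * (1 - ρ (lvl K s)) ≤ u K t s x ∧ u K t s x < θ (lvl K s)})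
    (hmass : ∀ K t, |t| ≤ l₀ → ∀ s ∈ S K,
      μ' K t s Set.univ ≤ ENNReal.ofReal (M (lvl K s)) * μ K t s Set.univ)
    (hac' : ∀ K t, |t| ≤ l₀ → ∀ s ∈ S K,
      SlotAntiConcentration (μ' K t s) (u K t s) (θ (lvl K s)) (ρ (lvl K s)) (Dslot K t s)) :
    ∀ K t, |t| ≤ l₀ → ∀ s ∈ S K,
      SlotAntiConcentration (μ K t s) (u K t s) (θ (lvl K s)) (ρ (lvl K s)) (Dslot K t s * M (lvl K s)) :=
  fun K t ht s hs => slotAntiConcentration_of_dominated (hDslot0 K t ht s hs) (hρ _) (hS K t ht s hs)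
    (hac' K t ht s hs) (hmass K t ht s hs)

/-- **SM-L6 PER SLOT, LEVEL-CONSTANT FORM (END-I's `hac` verbatim).**  The same PLUS a displayed level majorant
`Dslot K t s · M (lvl K s) ≤ D (lvl K s)` ⟹ END-I's wall binder with constants by level (the seam's
`hac_of_slotConst`). [folklore] -/
theorem hac_dominated_level (hρ : ∀ j, 0 ≤ ρ j) (hDslot0 : ∀ K t, |t| ≤ l₀ → ∀ s ∈ S K, 0 ≤ Dslot K t s)
    (hS : ∀ K t, |t| ≤ l₀ → ∀ s ∈ S K,
      μ K t s {x | θ (lvl K s) * (1 - ρ (lvl K s)) ≤ u K t s x ∧ u K t s x < θ (lvl K s)} ≤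
        μ' K t s {x | θ (lvl K s) * (1 - ρ (lvl K s)) ≤ u K t s x ∧ u K t s x < θ (lvl K s)})
    (hmass : ∀ K t, |t| ≤ l₀ → ∀ s ∈ S K,
      μ' K t s Set.univ ≤ ENNReal.ofReal (M (lvl K s)) * μ K t s Set.univ)
    (hDM : ∀ K t, |t| ≤ l₀ → ∀ s ∈ S K, Dslot K t s * M (lvl K s) ≤ D (lvl K s))
    (hac' : ∀ K t, |t| ≤ l₀ → ∀ s ∈ S K,
      SlotAntiConcentration (μ' K t s) (u K t s) (θ (lvl K s)) (ρ (lvl K s)) (Dslot K t s)) :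
    ∀ K t, |t| ≤ l₀ → ∀ s ∈ S K,
      SlotAntiConcentration (μ K t s) (u K t s) (θ (lvl K s)) (ρ (lvl K s)) (D (lvl K s)) :=
  hac_of_slotConst (Dslot := fun K t s => Dslot K t s * M (lvl K s)) hρ hDM
    (hac_dominated_slot hρ hDslot0 hS hmass hac')

end AnyFamily

/-! ## §2 The realized `SU(2)` slot family: density domination -/

/-- a pointwise smaller density gives a set-wise smaller tilted measure (Mathlib `withDensity_mono`). [folklore] -/
theorem withDensity_apply_le_of_le {Ω : Type*} [MeasurableSpace Ω] (ν : Measure Ω) {f g : Ω → ℝ≥0∞}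
    (hfg : ∀ x, f x ≤ g x) (A : Set Ω) : ν.withDensity f A ≤ ν.withDensity g A :=
  Measure.le_iff'.1 (withDensity_mono (Filter.Eventually.of_forall hfg)) A

section Realized

variable {σ : Type*} {P : Params} {l₀ : ℝ} {S : ℕ → Finset σ} {lvl : ℕ → σ → ℕ}
  {F F' : ∀ K : ℕ, ℝ → ∀ s : σ, GaugeField P (lvl K s) SU2 → ℝ≥0∞}
  {u : ∀ K : ℕ, ℝ → ∀ s : σ, GaugeField P (lvl K s) SU2 → ℝ} {θ D ρ M : ℕ → ℝ} {Dslot : ℕ → ℝ → σ → ℝ}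

/-- **SM-L6 (MR)_j WIRED, REALIZED `SU(2)` FAMILY — the seam END's `hacX` (slot-constant form).**  Per slot: the run's
ACTUAL density `F K t s` (own indicator removed; exterior straddling co-tests inside) is DOMINATED pointwise by an
END-II-amenable density `F′ K t s` (the straddling factors, each `≤ 1`, dropped); (M1) holds for
`(fieldMeasure P (lvl K s) SU2).withDensity (F′ K t s)` with slot constant `Dslot K t s ≥ 0` — END-II's OUTPUT shape
(`ShellMeasureRootCompositionSU2` ∕ `…LevelZero._cube` ∕ `ShellMeasureRootCompositionSeam.slotAC_realized_su2_of_levelData_le`);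
and the MASS RATIO BY LEVEL `∫ F′ ≤ M_{lvl K s} · ∫ F` (as `μ′(univ) ≤ ofReal M · μ(univ)`) is DISPLAYED — SM-L6 at level
`lvl K s`, small-field dominance, NOT PRINTED as an instance.  CONCLUSION: (M1) for the ACTUAL slot measure with slot
constant `Dslot K t s · M (lvl K s)` — feed it to `shellWeightBound_of_levelDataSU2` as `hacX` with
`DslotX := fun K t s => Dslot K t s * M (lvl K s)`.  CONDITIONAL on every binder. [folklore] -/
theorem hac_dominatedLevelData (hρ : ∀ j, 0 ≤ ρ j) (hDslot0 : ∀ K t, |t| ≤ l₀ → ∀ s ∈ S K, 0 ≤ Dslot K t s)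
    (hF : ∀ K t s U, F K t s U ≤ F' K t s U)
    (hmass : ∀ K t, |t| ≤ l₀ → ∀ s ∈ S K,
      ((fieldMeasure P (lvl K s) SU2).withDensity (F' K t s)) Set.univ ≤
        ENNReal.ofReal (M (lvl K s)) * ((fieldMeasure P (lvl K s) SU2).withDensity (F K t s)) Set.univ)
    (hac' : ∀ K t, |t| ≤ l₀ → ∀ s ∈ S K,
      SlotAntiConcentration ((fieldMeasure P (lvl K s) SU2).withDensity (F' K t s)) (u K t s)
        (θ (lvl K s)) (ρ (lvl K s)) (Dslot K t s)) :
    ∀ K t, |t| ≤ l₀ → ∀ s ∈ S K,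
      SlotAntiConcentration ((fieldMeasure P (lvl K s) SU2).withDensity (F K t s)) (u K t s)
        (θ (lvl K s)) (ρ (lvl K s)) (Dslot K t s * M (lvl K s)) :=
  hac_dominated_slot (μ := fun K t s => (fieldMeasure P (lvl K s) SU2).withDensity (F K t s))
    (μ' := fun K t s => (fieldMeasure P (lvl K s) SU2).withDensity (F' K t s)) hρ hDslot0
    (fun K t _ s _ => withDensity_apply_le_of_le _ (hF K t s) _) hmass hac'

/-- **… LEVEL-CONSTANT FORM (END-I's `hac` verbatim for the realized family)**: the same PLUS a displayed level
majorant `Dslot K t s · M (lvl K s) ≤ D (lvl K s)`. [folklore] -/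
theorem hac_dominatedLevelData_level (hρ : ∀ j, 0 ≤ ρ j) (hDslot0 : ∀ K t, |t| ≤ l₀ → ∀ s ∈ S K, 0 ≤ Dslot K t s)
    (hF : ∀ K t s U, F K t s U ≤ F' K t s U)
    (hmass : ∀ K t, |t| ≤ l₀ → ∀ s ∈ S K,
      ((fieldMeasure P (lvl K s) SU2).withDensity (F' K t s)) Set.univ ≤
        ENNReal.ofReal (M (lvl K s)) * ((fieldMeasure P (lvl K s) SU2).withDensity (F K t s)) Set.univ)
    (hDM : ∀ K t, |t| ≤ l₀ → ∀ s ∈ S K, Dslot K t s * M (lvl K s) ≤ D (lvl K s))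
    (hac' : ∀ K t, |t| ≤ l₀ → ∀ s ∈ S K,
      SlotAntiConcentration ((fieldMeasure P (lvl K s) SU2).withDensity (F' K t s)) (u K t s)
        (θ (lvl K s)) (ρ (lvl K s)) (Dslot K t s)) :
    ∀ K t, |t| ≤ l₀ → ∀ s ∈ S K,
      SlotAntiConcentration ((fieldMeasure P (lvl K s) SU2).withDensity (F K t s)) (u K t s)
        (θ (lvl K s)) (ρ (lvl K s)) (D (lvl K s)) :=
  hac_of_slotConst (μ := fun K t s => (fieldMeasure P (lvl K s) SU2).withDensity (F K t s))
    (Dslot := fun K t s => Dslot K t s * M (lvl K s)) hρ hDM (hac_dominatedLevelData hρ hDslot0 hF hmass hac')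

end Realized

end Summit.QuantumFields.BalabanUV.T4Continuum.ShellMeasureSeamDominated

end
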